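import Literature.AnabelianGeometry.EtaleTheta.Discharge.Sec1Thm110iiiBetaSideTransport
import HarnessLib

/-!
# [EtTh] Thm. 1.10 (iii) at the produced cusp data — the `ε_±`-datum in NORMALISER form («the cusp of `X` is `ε_±`-stable»)
# instead of the pointwise (centraliser) form, and on the α-side only (proof-only)

S. Mochizuki, *The étale theta function …* [EtTh], Publ. RIMS **45** (2009), Thm. 1.10 (iii) p. 30, Def. 1.7 p. 27 («`ε_± ∈ Gal(Ẍ/C)` the
unique nontrivial element that acts trivially on the set of cusps of `Ẍ`») [cite: MochizukiEtTh2009, Thm 1.10 (iii) p.30]. Layer L2 of the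
abc-iut cell, node EtTh:Thm1.10(iii); seat abc-iut-L2-t1 (gen 12; sequel of abc-iut-L2-lead R1316/R1323). PROOF-ONLY over abc-iut-w5-d029's
p494291 (`hpair_ofStructureGroupIso_of_mem`, `thm110iiiGalSect_of_genuineTorsor_v3` inputs, `inv_mul_epsPM_mem_dotC_of_not_mem`) and this
seat's p509936 (`Thm110Hypothesis.exists_map_epsPM_eq`, `map_inclX`) — BY NAME.

WHY. The β-side (resp. α-side) `ε_±`-datum of p494291 / p509936 is POINTWISE: `ε_±·inclX(d)·ε_±⁻¹ = inclX(Γ₀⁻¹ d Γ₀)` on `D_x`, i.e. `g₁ := inclX(Γ₀)·ε_±`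
CENTRALISES `inclX(D_x)` — a Krull-model-shaped law (true at `inversionModelκ′`, where `D_x` is untwisted) which a slim setting cannot
satisfy. p494291's proof uses it only through the SET-WISE invariance of `inclX(D_x)` and `inclX(I_x)` under `conj(g₁)`. THIS FILE re-proves
the closers under the weaker, print-shaped hypothesis
  `hN : MulAut.conj (inclX Γ₀·ε_±)⁻¹ • (D_x.map inclX) = D_x.map inclX`  — «`g₁` NORMALISES `inclX(D_x)`»,
i.e. the decomposition group in `Π^tp_C` of the image of the cusp `x` meets `Π^tp_C ∖ Π^tp_X` (the cusp of `X` is `±`-stable, Def. 1.7);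
the inertia clause follows (`I_x = D_x ∩ Δ^tp_X`, `Δ^tp_X` stable under `Π^tp_C`-conjugation, `CLevelData.map_deltaTemp_conjX`).
* `hpair_ofStructureGroupIso_of_not_mem_normalizer` — (b1), cusp-swapping case, under `hN`;
* `thm110iiiGalSect_ofStructureGroupIso_of_decompTransport_normalizer` — p494291's closer with β-side {`hN`, `g₁ ∉ Π^tp_Ċβ`};
* `Thm110Hypothesis.normalizer_of_alphaSide` — the β-side normaliser datum TRANSPORTED from an α-side one along `Γ`
  (`g₁β := inclX(k)⁻¹·Γ(g₁α)·inclX(k)`);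
* **`thm110iiiGalSect_ofStructureGroupIso_of_isoPreservesCuspidalDecomp_alphaNormalizer`** — Thm. 1.10 (iii) AS TYPED at the produced data
  ⟸ {[SemiAnbd] 6.5 (iii) + C16 · F-0007 · α-side NORMALISER datum {`g₁α = inclX(Γ₀α)·ε_±α` normalises `inclX(D_{xα})`, `g₁α ∉ Π^tp_{Ċα}`} · (b3)}.
HONEST FRAMING: inputs BY NAME, none asserted; «AS TYPED» as in p494291; typed ≠ proved; no side is taken on [IUTchIII] Cor. 3.12.
-/

namespace Literature.AnabelianGeometry.EtaleTheta

open Literature.AnabelianGeometry.SemiGraphs Literature.AnabelianGeometry.AbsoluteAnabelian GalSect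
open MuTwoSetting MuTwoSetting.DotCCusp
open scoped Pointwise

section NormalizerForm


variable {p : ℕ} [Fact p.Prime] {Mα Mβ : MuTwoSetting p} {εα : Mα.GtpC} {εβ : Mβ.GtpC}
  {hCα : Mα.toThetaSetting.Compat} {hCβ : Mβ.toThetaSetting.Compat}
  {Eα : Mα.toThetaSetting.EtaleThetaData} {Eβ : Mβ.toThetaSetting.EtaleThetaData}
  {γ : Mα.dotC εα ≃ₜ* Mβ.dotC εβ} [T1Space Mα.GtpC] [T1Space Mβ.GtpC]
  (H : Thm110Hypothesis εα εβ hCα hCβ Eα Eβ γ)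
  (Sα : Mα.StandardData Eα.toKummerData) (Sβ : Mβ.StandardData Eβ.toKummerData)
  -- the produced cusp data, sides α and β
  (eα : Mα.CLevelData) {xα : Mα.Pt} (hxα : Mα.IsCusp xα) (hDα : Mα.decomp xα ≤ Mα.GtpXdd)
  {S₀α : Subgroup Mα.PiTemp} (hS₀α : S₀α ∈ (cuspPairOf Mα.toTemperedCurve xα).splittings)
  (κα : haveI := isMulCommutative_pushforward_I eα hxα
    haveI := ((cuspPairOf Mα.toTemperedCurve xα).pushforward Mα.inclX).ID_normal
    KxHat Mα.toTemperedCurve ≃*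
      ↥(ContH1.resKer ((cuspPairOf Mα.toTemperedCurve xα).pushforward Mα.inclX).ID
        (⊤ : Subgroup ((cuspPairOf Mα.toTemperedCurve xα).pushforward Mα.inclX).D)
        (((cuspPairOf Mα.toTemperedCurve xα).pushforward Mα.inclX).isClosedComplement_of_mem_splittings
          (map_inclX_mem_splittings eα hS₀α)).le_left))
  (eβ : Mβ.CLevelData) {xβ : Mβ.Pt} (hxβ : Mβ.IsCusp xβ) (hDβ : Mβ.decomp xβ ≤ Mβ.GtpXdd)
  {S₀β : Subgroup Mβ.PiTemp} (hS₀β : S₀β ∈ (cuspPairOf Mβ.toTemperedCurve xβ).splittings)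
  (κβ : haveI := isMulCommutative_pushforward_I eβ hxβ
    haveI := ((cuspPairOf Mβ.toTemperedCurve xβ).pushforward Mβ.inclX).ID_normal
    KxHat Mβ.toTemperedCurve ≃*
      ↥(ContH1.resKer ((cuspPairOf Mβ.toTemperedCurve xβ).pushforward Mβ.inclX).ID
        (⊤ : Subgroup ((cuspPairOf Mβ.toTemperedCurve xβ).pushforward Mβ.inclX).D)
        (((cuspPairOf Mβ.toTemperedCurve xβ).pushforward Mβ.inclX).isClosedComplement_of_mem_splittings
          (map_inclX_mem_splittings eβ hS₀β)).le_left))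


omit [T1Space Mα.GtpC] [T1Space Mβ.GtpC] in
/-- `inclX(Δ^tp_X)` is stable under conjugation by any `g ∈ Π^tp_C` (via `CLevelData.conjX`). [cite: MochizukiEtTh2009, Def 2.1 p.36] -/
theorem conj_smul_map_inclX_deltaTemp (e : Mβ.CLevelData) (g : Mβ.GtpC) :
    MulAut.conj g • Mβ.toThetaSetting.toTemperedCurve.DeltaTemp.map Mβ.inclX =
      Mβ.toThetaSetting.toTemperedCurve.DeltaTemp.map Mβ.inclX := by
  ext y
  rw [Subgroup.mem_smul_pointwise_iff_exists, Subgroup.mem_map]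
  constructor
  · rintro ⟨_, ⟨d, hd, rfl⟩, rfl⟩
    refine ⟨e.conjX g d, (e.conjX_mem_deltaTemp_iff g d).2 hd, ?_⟩
    rw [MulAut.smul_def, MulAut.conj_apply]
    exact e.inclX_conjX g d
  · rintro ⟨d, hd, rfl⟩
    refine ⟨Mβ.inclX ((e.conjX g).symm d), ⟨(e.conjX g).symm d, ?_, rfl⟩, ?_⟩
    · exact (e.conjX_mem_deltaTemp_iff g _).1 (by rw [(e.conjX g).apply_symm_apply]; exact hd)
    · rw [MulAut.smul_def, MulAut.conj_apply, ← e.inclX_conjX g, (e.conjX g).apply_symm_apply]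

/-- **(b1), cusp-swapping case, NORMALISER form**: if `g₁ := inclX(Γ₀)·ε_±` NORMALISES `inclX(D_{xβ})` (hypothesis `hN`), then with
`c := (inclX(k·Γ₀)·ε_±)⁻¹` the map `Γ ∘ Inn(c)` carries the produced pair of `α` EXACTLY onto that of `β`.
[cite: MochizukiEtTh2009, Thm 1.10 (iii) p.30] -/
theorem hpair_ofStructureGroupIso_of_not_mem_normalizer {k : Mβ.PiTemp}
    (hX0 : (Mα.decomp xα).map H.γX.toMulEquiv.toMonoidHom = MulAut.conj k • Mβ.decomp xβ)
    (hΔX : Mα.toThetaSetting.toTemperedCurve.DeltaTemp.map H.γX.toMulEquiv.toMonoidHom =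
      Mβ.toThetaSetting.toTemperedCurve.DeltaTemp)
    {Γ₀ : Mβ.PiTemp} (hN : MulAut.conj (Mβ.inclX Γ₀ * Mβ.epsPM)⁻¹ • (Mβ.decomp xβ).map Mβ.inclX = (Mβ.decomp xβ).map Mβ.inclX) :
    (ofStructureGroupIso eα εα hxα hDα hS₀α κα).pair.map
        (H.Γ.trans (Mβ.innerAutC (Mβ.inclX (k * Γ₀) * Mβ.epsPM)⁻¹)) =
      (ofStructureGroupIso eβ εβ hxβ hDβ hS₀β κβ).pair := by
  have hc : (Mβ.inclX (k * Γ₀) * Mβ.epsPM)⁻¹ * Mβ.inclX k = (Mβ.inclX Γ₀ * Mβ.epsPM)⁻¹ := by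
    rw [map_mul]; group
  have hI : MulAut.conj (Mβ.inclX Γ₀ * Mβ.epsPM)⁻¹ • (Mβ.toThetaSetting.toTemperedCurve.inertia xβ).map Mβ.inclX =
      (Mβ.toThetaSetting.toTemperedCurve.inertia xβ).map Mβ.inclX := by
    change MulAut.conj _ • (Mβ.decomp xβ ⊓ Mβ.toThetaSetting.toTemperedCurve.DeltaTemp).map Mβ.inclX =
      (Mβ.decomp xβ ⊓ Mβ.toThetaSetting.toTemperedCurve.DeltaTemp).map Mβ.inclX
    rw [Subgroup.map_inf _ _ _ Mβ.injective_inclX, Subgroup.smul_inf, hN, conj_smul_map_inclX_deltaTemp eβ _]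
  refine GalSect.CuspPair.ext' ?_ ?_
  · change (((cuspPairOf Mα.toTemperedCurve xα).pushforward Mα.inclX).D).map _ =
      ((cuspPairOf Mβ.toTemperedCurve xβ).pushforward Mβ.inclX).D
    rw [GalSect.CuspPair.pushforward_D, GalSect.CuspPair.pushforward_D]
    change ((Mα.decomp xα).map Mα.inclX).map _ = (Mβ.decomp xβ).map Mβ.inclX
    rw [map_trans_innerAutC_map_inclX H, hX0, DotCCusp.map_inclX_conj_smul, smul_smul, ← map_mul, hc]
    exact hN
  · rw [GalSect.CuspPair.map_I]
    change ((Mα.toThetaSetting.toTemperedCurve.inertia xα).map Mα.inclX).map _ =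
      (Mβ.toThetaSetting.toTemperedCurve.inertia xβ).map Mβ.inclX
    rw [map_trans_innerAutC_map_inclX H, map_inertia_eq_of_map_decomp_eq H hX0 hΔX, DotCCusp.map_inclX_conj_smul,
      smul_smul, ← map_mul, hc]
    exact hI

/-- **Thm. 1.10 (iii) AS TYPED at the two produced data, β-side NORMALISER form**: p494291's
`thm110iiiGalSect_ofStructureGroupIso_of_decompTransport` with the pointwise `ε_±`-law replaced by `hN`.
[cite: MochizukiEtTh2009, Thm 1.10 (iii) p.30] -/
theorem thm110iiiGalSect_ofStructureGroupIso_of_decompTransport_normalizer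
    {k : Mβ.PiTemp} (hX0 : (Mα.decomp xα).map H.γX.toMulEquiv.toMonoidHom = MulAut.conj k • Mβ.decomp xβ)
    {Γ₀ : Mβ.PiTemp} (hN : MulAut.conj (Mβ.inclX Γ₀ * Mβ.epsPM)⁻¹ • (Mβ.decomp xβ).map Mβ.inclX = (Mβ.decomp xβ).map Mβ.inclX)
    (hnot : Mβ.inclX Γ₀ * Mβ.epsPM ∉ Mβ.dotC εβ)
    (Fα Fβ : Literature.AnabelianGeometry.AbsoluteAnabelian.FundamentalExtension.{0})
    (fα : Fα.arith ≃ₜ* Mα.PiHat) (fβ : Fβ.arith ≃ₜ* Mβ.PiHat)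
    (hfα : Fα.geom.map fα.toMulEquiv.toMonoidHom = Mα.DeltaHat) (hfβ : Fβ.geom.map fβ.toMulEquiv.toMonoidHom = Mβ.DeltaHat)
    (h138 : ∀ Φ : Mα.PiHat ≃ₜ* Mβ.PiHat, (∀ y : Mα.PiTemp, Φ (Mα.toHat y) = Mβ.toHat (H.γX y)) →
      Literature.AnabelianGeometry.AbsoluteAnabelian.FundamentalExtension.PreservesGeom (F := Fβ) (fα.trans (Φ.trans fβ.symm)))
    (hecan : ∀ c ∈ Mβ.dotC εβ,
      ∀ (t : (ofStructureGroupIso eα εα hxα hDα hS₀α κα).pair.SplittingClass →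
        (ofStructureGroupIso eβ εβ hxβ hDβ hS₀β κβ).pair.SplittingClass),
      (∀ (S : Subgroup Mα.GtpC) (hS : S ∈ (ofStructureGroupIso eα εα hxα hDα hS₀α κα).pair.splittings),
        ∃ h', t (GalSect.CuspPair.SplittingClass.mk (ofStructureGroupIso eα εα hxα hDα hS₀α κα).pair S hS) =
          GalSect.CuspPair.SplittingClass.mk (ofStructureGroupIso eβ εβ hxβ hDβ hS₀β κβ).pair
            (S.map (H.Γ.trans (Mβ.innerAutC c)).toMulEquiv.toMonoidHom) h') →
      t '' (ofStructureGroupIso eα εα hxα hDα hS₀α κα).canonical ⊆ (ofStructureGroupIso eβ εβ hxβ hDβ hS₀β κβ).canonical) :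
    Thm110iiiGalSect H Sα Sβ (ofStructureGroupIso eα εα hxα hDα hS₀α κα) (ofStructureGroupIso eβ εβ hxβ hDβ hS₀β κβ) := by
  classical
  obtain ⟨Φ, hΦ⟩ := Mα.toThetaSetting.toTemperedCurve.exists_isoCompletion Mβ.toThetaSetting.toTemperedCurve H.γX
  have hΔX : Mα.toThetaSetting.toTemperedCurve.DeltaTemp.map H.γX.toMulEquiv.toMonoidHom =
      Mβ.toThetaSetting.toTemperedCurve.DeltaTemp :=
    Mα.toThetaSetting.map_deltaTemp_eq_of_preservesGeom_iso Mβ.toThetaSetting H.γX Φ hΦ Fα Fβ fα fβ hfα hfβ (h138 Φ hΦ)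
  by_cases hk : Mβ.inclX k ∈ Mβ.dotC εβ
  · have hc : (Mβ.inclX k)⁻¹ ∈ Mβ.dotC εβ := Subgroup.inv_mem _ hk
    exact thm110iiiGalSect_of_genuineTorsor_v3 H Sα Sβ _ _ hc
      (hpair_ofStructureGroupIso_of_mem H eα hxα hDα hS₀α κα eβ hxβ hDβ hS₀β κβ hX0 hΔX)
      (map_inclX_mem_splittings eα hS₀α) (map_inclX_mem_splittings eβ hS₀β)
      (ofStructureGroupIso_hgen eα εα hxα hDα hS₀α κα) (ofStructureGroupIso_hgen eβ εβ hxβ hDβ hS₀β κβ) (hecan _ hc)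
  · have hc := inv_mul_epsPM_mem_dotC_of_not_mem (εβ := εβ) H.admβ hk hnot
    exact thm110iiiGalSect_of_genuineTorsor_v3 H Sα Sβ _ _ hc
      (hpair_ofStructureGroupIso_of_not_mem_normalizer H eα hxα hDα hS₀α κα eβ hxβ hDβ hS₀β κβ hX0 hΔX hN)
      (map_inclX_mem_splittings eα hS₀α) (map_inclX_mem_splittings eβ hS₀β)
      (ofStructureGroupIso_hgen eα εα hxα hDα hS₀α κα) (ofStructureGroupIso_hgen eβ εβ hxβ hDβ hS₀β κβ) (hecan _ hc)

omit [T1Space Mα.GtpC] [T1Space Mβ.GtpC] in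
/-- **The β-side NORMALISER datum transported from the α-side** along `Γ`: if `g₁α := inclX(Γ₀α)·ε_±α` normalises `inclX(D_{xα})`,
`γ_X(D_{xα}) = k·D_{xβ}·k⁻¹`, and `g₁α ∉ Π^tp_{Ċα}`, then `g₁β := inclX(k)⁻¹·Γ(g₁α)·inclX(k) = inclX(Γ₀β)·ε_±β` for some `Γ₀β`,
it normalises `inclX(D_{xβ})`, and `g₁β ∉ Π^tp_{Ċβ}`. [cite: MochizukiEtTh2009, Thm 1.10 (iii) p.30] -/
theorem normalizer_of_alphaSide {k : Mβ.PiTemp}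
    (hX0 : (Mα.decomp xα).map H.γX.toMulEquiv.toMonoidHom = MulAut.conj k • Mβ.decomp xβ)
    {Γ₀ : Mα.PiTemp} (hN : MulAut.conj (Mα.inclX Γ₀ * Mα.epsPM)⁻¹ • (Mα.decomp xα).map Mα.inclX = (Mα.decomp xα).map Mα.inclX)
    (hnot : Mα.inclX Γ₀ * Mα.epsPM ∉ Mα.dotC εα) :
    ∃ Γ₀β : Mβ.PiTemp,
      MulAut.conj (Mβ.inclX Γ₀β * Mβ.epsPM)⁻¹ • (Mβ.decomp xβ).map Mβ.inclX = (Mβ.decomp xβ).map Mβ.inclX ∧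
      Mβ.inclX Γ₀β * Mβ.epsPM ∉ Mβ.dotC εβ := by
  obtain ⟨m, hm⟩ := H.exists_map_epsPM_eq
  refine ⟨k⁻¹ * H.γX (Γ₀ * CLevelData.conjFun Mα.epsPM (H.γX.symm k)) * m, ?_, H.not_mem_dotC_of_alphaSide k hnot hm⟩
  rw [H.inclX_gamma0_mul_epsPM k Γ₀ hm]
  -- `inclX(D_{xβ}) = inclX(k)⁻¹·Γ(inclX(D_{xα}))·inclX(k)`
  have hD : (Mβ.decomp xβ).map Mβ.inclX =
      MulAut.conj (Mβ.inclX k)⁻¹ • ((Mα.decomp xα).map Mα.inclX).map H.Γ.toMulEquiv.toMonoidHom := by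
    rw [map_Γ_map_inclX H, hX0, DotCCusp.map_inclX_conj_smul, smul_smul, ← map_mul, inv_mul_cancel, map_one, one_smul]
  have hΓN : MulAut.conj (H.Γ (Mα.inclX Γ₀ * Mα.epsPM))⁻¹ • ((Mα.decomp xα).map Mα.inclX).map H.Γ.toMulEquiv.toMonoidHom =
      ((Mα.decomp xα).map Mα.inclX).map H.Γ.toMulEquiv.toMonoidHom := by
    have h := congrArg (Subgroup.map H.Γ.toMulEquiv.toMonoidHom) hN
    rw [GalSect.map_conj_smul, map_inv] at h
    exact h
  have hgrp : ((Mβ.inclX k)⁻¹ * H.Γ (Mα.inclX Γ₀ * Mα.epsPM) * Mβ.inclX k)⁻¹ * (Mβ.inclX k)⁻¹ =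
      (Mβ.inclX k)⁻¹ * (H.Γ (Mα.inclX Γ₀ * Mα.epsPM))⁻¹ := by group
  rw [hD, smul_smul, ← map_mul, hgrp, map_mul, ← smul_smul, hΓN]

/-- **Thm. 1.10 (iii) AS TYPED at the produced data, α-side NORMALISER form**: ⟸ {[SemiAnbd] Thm. 6.5 (iii) + C16 · F-0007 ([AbsAnab] 1.3.8) ·
α-side {`g₁α := inclX(Γ₀α)·ε_±α` NORMALISES `inclX(D_{xα})` — «the cusp of `Xα` is `ε_±`-stable», `g₁α ∉ Π^tp_{Ċα}`} · (b3)} — no pointwise/centraliser law,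
no β-side datum. [cite: MochizukiEtTh2009, Thm 1.10 (iii) p.30] -/
theorem thm110iiiGalSect_ofStructureGroupIso_of_isoPreservesCuspidalDecomp_alphaNormalizer
    (h65 : Mα.toThetaSetting.toTemperedCurve.IsoPreservesCuspidalDecomp Mβ.toThetaSetting.toTemperedCurve)
    (huniq : ∀ x' : Mβ.Pt, Mβ.IsCusp x' → x' = xβ)
    {Γ₀ : Mα.PiTemp} (hN : MulAut.conj (Mα.inclX Γ₀ * Mα.epsPM)⁻¹ • (Mα.decomp xα).map Mα.inclX = (Mα.decomp xα).map Mα.inclX)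
    (hnot : Mα.inclX Γ₀ * Mα.epsPM ∉ Mα.dotC εα)
    (Fα Fβ : Literature.AnabelianGeometry.AbsoluteAnabelian.FundamentalExtension.{0})
    (fα : Fα.arith ≃ₜ* Mα.PiHat) (fβ : Fβ.arith ≃ₜ* Mβ.PiHat)
    (hfα : Fα.geom.map fα.toMulEquiv.toMonoidHom = Mα.DeltaHat) (hfβ : Fβ.geom.map fβ.toMulEquiv.toMonoidHom = Mβ.DeltaHat)
    (h138 : ∀ Φ : Mα.PiHat ≃ₜ* Mβ.PiHat, (∀ y : Mα.PiTemp, Φ (Mα.toHat y) = Mβ.toHat (H.γX y)) →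
      Literature.AnabelianGeometry.AbsoluteAnabelian.FundamentalExtension.PreservesGeom (F := Fβ) (fα.trans (Φ.trans fβ.symm)))
    (hecan : ∀ c ∈ Mβ.dotC εβ,
      ∀ (t : (ofStructureGroupIso eα εα hxα hDα hS₀α κα).pair.SplittingClass →
        (ofStructureGroupIso eβ εβ hxβ hDβ hS₀β κβ).pair.SplittingClass),
      (∀ (S : Subgroup Mα.GtpC) (hS : S ∈ (ofStructureGroupIso eα εα hxα hDα hS₀α κα).pair.splittings),
        ∃ h', t (GalSect.CuspPair.SplittingClass.mk (ofStructureGroupIso eα εα hxα hDα hS₀α κα).pair S hS) =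
          GalSect.CuspPair.SplittingClass.mk (ofStructureGroupIso eβ εβ hxβ hDβ hS₀β κβ).pair
            (S.map (H.Γ.trans (Mβ.innerAutC c)).toMulEquiv.toMonoidHom) h') →
      t '' (ofStructureGroupIso eα εα hxα hDα hS₀α κα).canonical ⊆ (ofStructureGroupIso eβ εβ hxβ hDβ hS₀β κβ).canonical) :
    Thm110iiiGalSect H Sα Sβ (ofStructureGroupIso eα εα hxα hDα hS₀α κα) (ofStructureGroupIso eβ εβ hxβ hDβ hS₀β κβ) := by
  obtain ⟨k, hX0⟩ := exists_conj_decomp_eq_of_isoPreservesCuspidalDecomp H hxα h65 huniq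
  obtain ⟨Γ₀β, hNβ, hnotβ⟩ := normalizer_of_alphaSide H hX0 hN hnot
  exact thm110iiiGalSect_ofStructureGroupIso_of_decompTransport_normalizer H Sα Sβ eα hxα hDα hS₀α κα eβ hxβ hDβ hS₀β κβ
    hX0 hNβ hnotβ Fα Fβ fα fβ hfα hfβ h138 hecan

end NormalizerForm

end Literature.AnabelianGeometry.EtaleTheta
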